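import Mathlib
import HarnessLib
import Literature.Computability.AlgebraicComplexity.PatternExpressions
import Literature.Combinatorics.SimpleGraph.TreeDecomposition
import Summits.ValiantsHypothesis.ValiantsHypothesis.Theorems.MonotoneRestorationMonotoneRestorationQPLinearWidthDefs

/-!
# Route MonotoneRestoration, crux `MonotoneRestorationQP` (stmt-15886), line `linear-width` —
# WHAT `HomIndist n 2` SEES AT ROUND ZERO: power sums of the entries and of the row / column sums

Helper file (`--supports stmt-ValiantsHypothesis-15886`), def-free.  Two concrete families of patterns of
treewidth `≤ 1` and their homomorphism polynomials, and the resulting invariants of `HomIndist n k` (`k ≥ 2`),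
in the vocabulary of `…LinearWidthDefs.lean`:

* `homPoly_replicate_edge`, `treewidth_edgePattern_le_one` — the `m`-fold edge on `Fin 1 × Fin 1` has
  `hom = Σ_{ij} x_ij^m` and pattern graph of treewidth `≤ 1`;
* `eval_powerSum_eq_of_homIndist` — hence hom-indistinguishable points (below any width `k ≥ 2`) have the
  same POWER SUMS of entries `Σ_{ij} A_ij^m` for every `m` (so, informally, the same multiset of entries; this
  is also the integrality of `ℂ[x]` over the narrow algebra used in the seminormality reading of (Q1),
  `…LinearWidthCuspTest.lean` / evidence Q1-PROBE.md);
* `homPoly_star`, `treewidth_starPattern_le_one` — the star `K_{1,m}` (centre a row vertex) has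
  `hom = Σ_i (Σ_j x_ij)^m` and treewidth `≤ 1` (a path decomposition with bags `{centre, leaf}`);
* `eval_rowSumPowerSum_eq_of_homIndist` — hence hom-indistinguishable points have the same power sums of
  ROW SUMS `Σ_i (Σ_j A_ij)^m` (the multiset of row sums; columns are symmetric and omitted).

Honest label: elementary bookkeeping (round-0/round-1 colour-refinement data in the kernel); no stub closed;
VP ≠ VNP not moved. [cite: DwivediPagoSeppelt2026, Def. 3.2; DellGroheRattan2018]
-/

-- `Summit.ValiantsHypothesis.ValiantsHypothesis.…` is the tree's mandated namespace (Sub = Summit).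
set_option linter.dupNamespace false

noncomputable section

namespace Summit.ValiantsHypothesis.ValiantsHypothesis.Theorems.MonotoneRestorationQPLinearWidth

namespace PowerSums

open Literature.Computability.AlgebraicComplexity MvPolynomial

variable {n : ℕ}

/-! ### The `m`-fold edge -/

/-- The homomorphism polynomial of the `m`-fold edge (pattern on `Fin 1 × Fin 1`) is the `m`-th power sum of
the entries: `Σ_{i,j} x_ij^m`. [folklore] -/
theorem homPoly_replicate_edge (m : ℕ) :
    homPoly (Multiset.replicate m ((0 : Fin 1), (0 : Fin 1))) n ℂ =
      ∑ ij : Fin n × Fin n, (X ij : MvPolynomial (Fin n × Fin n) ℂ) ^ m := by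
  unfold homPoly
  simp only [Multiset.map_replicate, Multiset.prod_replicate]
  refine Fintype.sum_equiv ((Equiv.funUnique (Fin 1) (Fin n)).prodCongr
    (Equiv.funUnique (Fin 1) (Fin n))) _ _ fun h => ?_
  rfl

/-- The pattern graph of any pattern on `Fin 1 × Fin 1` has treewidth `≤ 1` (two vertices). [folklore] -/
theorem treewidth_edgePattern_le_one (E : Multiset (Fin 1 × Fin 1)) :
    Literature.Combinatorics.SimpleGraph.treewidth
        (SimpleGraph.fromRel fun u v : Fin 1 ⊕ Fin 1 => ∃ e ∈ E, u = Sum.inl e.1 ∧ v = Sum.inr e.2) ≤ 1 := by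
  refine (Literature.Combinatorics.SimpleGraph.treewidth_le_card_sub_one _).trans ?_
  simp

/-- **Hom-indistinguishable points have the same power sums of entries** (`k ≥ 2`). [folklore] -/
theorem eval_powerSum_eq_of_homIndist {k : ℕ} (hk : 2 ≤ k) {A B : Fin n × Fin n → ℂ}
    (h : HomIndist n k A B) (m : ℕ) :
    ∑ ij : Fin n × Fin n, A ij ^ m = ∑ ij : Fin n × Fin n, B ij ^ m := by
  have := h 1 1 (Multiset.replicate m ((0 : Fin 1), (0 : Fin 1)))
    ((treewidth_edgePattern_le_one _).trans_lt (by omega))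
  rw [homPoly_replicate_edge] at this
  simpa [map_sum, map_pow, eval_X] using this

/-! ### Stars -/

/-- The homomorphism polynomial of the star `K_{1,m}` with a row centre (pattern on `Fin 1 × Fin m`, one edge
to each leaf) is `Σ_i (Σ_j x_ij)^m`. [folklore] -/
theorem homPoly_star (m : ℕ) :
    homPoly ((Finset.univ : Finset (Fin m)).val.map fun t => ((0 : Fin 1), t)) n ℂ =
      ∑ i : Fin n, (∑ j : Fin n, (X (i, j) : MvPolynomial (Fin n × Fin n) ℂ)) ^ m := by
  classical
  unfold homPoly
  rw [Fintype.sum_prod_type]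
  refine Fintype.sum_equiv (Equiv.funUnique (Fin 1) (Fin n)) _ _ fun h₁ => ?_
  have hprod : ∀ h₂ : Fin m → Fin n,
      (Multiset.map (fun e : Fin 1 × Fin m => (X ((h₁, h₂).1 e.1, (h₁, h₂).2 e.2) :
          MvPolynomial (Fin n × Fin n) ℂ))
        ((Finset.univ : Finset (Fin m)).val.map fun t => ((0 : Fin 1), t))).prod
        = ∏ t : Fin m, (X (h₁ 0, h₂ t) : MvPolynomial (Fin n × Fin n) ℂ) := by
    intro h₂
    rw [Multiset.map_map, Finset.prod_eq_multiset_prod]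
    rfl
  simp_rw [hprod]
  rw [← Fintype.prod_sum (fun (_ : Fin m) (j : Fin n) => (X (h₁ 0, j) : MvPolynomial (Fin n × Fin n) ℂ))]
  simp [Finset.prod_const]

/-- Treewidth of the star pattern `K_{1,m}` is `≤ 1`: the path decomposition with bags `{centre, leaf t}`.
[folklore] -/
theorem treewidth_starPattern_le_one (m : ℕ) :
    Literature.Combinatorics.SimpleGraph.treewidth
        (SimpleGraph.fromRel fun u v : Fin 1 ⊕ Fin m =>
          ∃ e ∈ ((Finset.univ : Finset (Fin m)).val.map fun t => ((0 : Fin 1), t)),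
            u = Sum.inl e.1 ∧ v = Sum.inr e.2) ≤ 1 := by
  rcases m with _ | k
  · refine (Literature.Combinatorics.SimpleGraph.treewidth_le_card_sub_one _).trans ?_
    simp
  · refine Literature.Combinatorics.SimpleGraph.treewidth_le_of_intervals _
      (fun t : Fin (k + 1) => ({Sum.inl 0, Sum.inr t} : Finset (Fin 1 ⊕ Fin (k + 1)))) ?_ ?_ ?_ ?_
    · intro u v huv
      rw [SimpleGraph.fromRel_adj] at huv
      obtain ⟨-, ⟨e, he, hu, hv⟩ | ⟨e, he, hv, hu⟩⟩ := huv
      · obtain ⟨t, -, rfl⟩ := Multiset.mem_map.mp he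
        exact ⟨t, by simp [hu, hv]⟩
      · obtain ⟨t, -, rfl⟩ := Multiset.mem_map.mp he
        exact ⟨t, by simp [hu, hv]⟩
    · rintro (u | t)
      · exact ⟨0, by simp [Subsingleton.elim u 0]⟩
      · exact ⟨t, by simp⟩
    · rintro (u | t)
      · have : {s : Fin (k + 1) | (Sum.inl u : Fin 1 ⊕ Fin (k + 1)) ∈
            ({Sum.inl 0, Sum.inr s} : Finset (Fin 1 ⊕ Fin (k + 1)))} = Set.univ := by
          ext s; simp [Subsingleton.elim u 0]
        rw [this]; exact Set.ordConnected_univ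
      · have : {s : Fin (k + 1) | (Sum.inr t : Fin 1 ⊕ Fin (k + 1)) ∈
            ({Sum.inl 0, Sum.inr s} : Finset (Fin 1 ⊕ Fin (k + 1)))} = {t} := by
          ext s; simp [eq_comm]
        rw [this]; exact Set.ordConnected_singleton
    · intro t
      exact (Finset.card_insert_le _ _).trans (by simp)

/-- **Hom-indistinguishable points have the same power sums of row sums** (`k ≥ 2`): the multiset of row
sums is a `HomIndist n 2`-invariant. [folklore] -/
theorem eval_rowSumPowerSum_eq_of_homIndist {k : ℕ} (hk : 2 ≤ k) {A B : Fin n × Fin n → ℂ}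
    (h : HomIndist n k A B) (m : ℕ) :
    ∑ i : Fin n, (∑ j : Fin n, A (i, j)) ^ m = ∑ i : Fin n, (∑ j : Fin n, B (i, j)) ^ m := by
  have := h 1 m ((Finset.univ : Finset (Fin m)).val.map fun t => ((0 : Fin 1), t))
    ((treewidth_starPattern_le_one m).trans_lt (by omega))
  rw [homPoly_star] at this
  simpa [map_sum, map_pow, eval_X] using this

end PowerSums

end Summit.ValiantsHypothesis.ValiantsHypothesis.Theorems.MonotoneRestorationQPLinearWidth

end
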